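import Mathlib
import Summits.PneNP.PneNP.Theorems.SymmetryBudgetHamCompilesFDagSem
import Summits.PneNP.PneNP.Theorems.SymmetryBudgetHamCompilesStubRref

/-!
# The F-side gate DAG of the line `kotzig-cutspan`: size and decoding
# (obligation `stub_symmetricF_out` of stub `stub_symmetricF`, crux `SymmetryBudget.HamCompiles`,
# stmt-PneNP-10637)

The last of the five proof obligations of the F-side DAG (`SymmetryBudgetHamCompilesFDag.lean`,
`SymmetryBudgetHamCompilesFDagSem.lean`, namespace `…HamCompilesKC.SymF`), `SymF.OutProps`:

* SIZE: the gate type `FΛ m = SymA.RΛ m ⊕ FG m` has at most `73 (m + 1)^11` elements. Every gate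
  label is a tuple of parameters each ranging over at most `(m + 1)^3` values (vertices `Fin m`,
  ranks `Fin g`, subsets of the free part `PSet m` — at most `2^g ≤ m + 1` of them since
  `|freeSet m| ≤ g = ⌊log₂ m⌋` —, cut coordinates `K m` (`2^g`), code words `Cd m` (`2^{3g}`),
  block indices `Fin 2^g`, rank pairs `Fin g²`); the exact cardinalities of `TCtx`, `ChCtx`, `BK`,
  `FG` are read off the `proxy_equiv%` equivalences behind their `Fintype` instances and then
  bounded monomial by monomial.
* DECODING: `fData m x (e, S, S') = [e is a code word] ∧ (echelon bit of Cspan F (dOf e) at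
  (S, S'))`, because the stars-and-bars code is injective on margins of mass `≤ 2g`
  (`sbCode_injOn`), so the decoded margins `dOf e` are the unique preimage of a code word `e`.
-/

-- `Summit.PneNP.PneNP.…` duplicates `PneNP` BY DESIGN (single-problem summit, D-0017).
set_option linter.dupNamespace false

noncomputable section

namespace Summit.PneNP.PneNP.Theorems.HamCompilesKC

open Literature.Computability.Complexity
open Finset

namespace SymF

/-! All auxiliary declarations of this file live in the sub-namespace `SymF.FOut`. -/
namespace FOut

variable {m : ℕ}

/-! ### Decoding: the margins coded by a code word -/

/-- The decoded margins of a code word have mass `≤ 2g` and code back to the word. -/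
theorem dOf_spec {e : Cd m} (h : Valid e) :
    (∑ t, dOf e t) ≤ 2 * gOf m ∧ sbCode (dOf e) = e := by
  have h' : ∃ d : Fin (gOf m) → ℕ, (∑ t, d t) ≤ 2 * gOf m ∧ sbCode d = e := h
  have hd : dOf e = Classical.choose h' := by
    unfold dOf
    rw [dif_pos h']
  rw [hd]
  exact Classical.choose_spec h'

/-- A code word of admissible margins `d` decodes to `d` (injectivity of the stars-and-bars
code). -/
theorem dOf_eq_of_sbCode_eq {e : Cd m} {d : Fin (gOf m) → ℕ} (hd : (∑ t, d t) ≤ 2 * gOf m)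
    (he : sbCode d = e) : dOf e = d :=
  have hv : Valid e := ⟨d, hd, he⟩
  sbCode_injOn (dOf_spec hv).1 hd ((dOf_spec hv).2.trans he.symm)

/-- The truth value of an entry of a reduced echelon table is the echelon bit. -/
theorem tb_rrefRow_iff {g : ℕ} (W : Submodule (ZMod 2) (Vec g)) (c c' : Fin g → Bool) :
    tb (rrefRow W c c') = true ↔ rrefBit W c c' := by
  unfold tb rrefRow
  by_cases h : rrefBit W c c' <;> simp [h]

/-- **Decoding.** The F-interface bit at `(e, S, S')` is the echelon bit of `Cspan F (dOf e)` at a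
code word `e`, and `false` at a non-code-word. -/
theorem fData_eq (m : ℕ) (x : Fin m × Fin m → Bool) (i : FIdx m) [Decidable (Valid i.1)] :
    fData m x i =
      (decide (Valid i.1) && tb (rrefRow (Cspan m x (freeSet m) (dOf i.1)) i.2.1 i.2.2)) := by
  rw [Bool.eq_iff_iff]
  simp only [fData, decide_eq_true_eq, Bool.and_eq_true]
  constructor
  · rintro ⟨d, hd, he, hbit⟩
    exact ⟨⟨d, hd, he⟩, (tb_rrefRow_iff _ _ _).2 (by rwa [dOf_eq_of_sbCode_eq hd he])⟩
  · rintro ⟨hv, hbit⟩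
    exact ⟨dOf i.1, (dOf_spec hv).1, (dOf_spec hv).2, (tb_rrefRow_iff _ _ _).1 hbit⟩

/-! ### Size: the parameter types -/

/-- `2^g ≤ m + 1` at the window `g = ⌊log₂ m⌋`. -/
theorem two_pow_gOf_le (m : ℕ) : 2 ^ gOf m ≤ m + 1 := by
  rcases Nat.eq_zero_or_pos m with rfl | hm
  · simp [gOf]
  · exact (Nat.pow_log_le_self 2 hm.ne').trans (Nat.le_succ m)

/-- `2^{3g} ≤ (m + 1)^3`. -/
theorem two_pow_three_mul_gOf_le (m : ℕ) : 2 ^ (3 * gOf m) ≤ (m + 1) ^ 3 := by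
  rw [pow_mul']
  exact Nat.pow_le_pow_left (two_pow_gOf_le m) 3

/-- There are `2^g` cut coordinates. -/
theorem card_K (m : ℕ) : Fintype.card (K m) = 2 ^ gOf m := by
  rw [Fintype.card_fun, Fintype.card_bool, Fintype.card_fin]

/-- There are `2^{3g}` code words. -/
theorem card_Cd (m : ℕ) : Fintype.card (Cd m) = 2 ^ (3 * gOf m) := by
  rw [Fintype.card_fun, Fintype.card_bool, Fintype.card_fin]

/-- There are at most `2^g` subsets of the free part (the free part has at most `g` vertices: a
free vertex `v` satisfies `m ≤ v + g`, so `v ↦ v + g - m` maps it injectively below `g`). -/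
theorem card_PSet_le (m : ℕ) : Fintype.card (PSet m) ≤ 2 ^ gOf m := by
  have hF : (freeSet m).card ≤ gOf m := by
    calc (freeSet m).card ≤ (Finset.range (gOf m)).card :=
          Finset.card_le_card_of_injOn (fun v : Fin m => (v : ℕ) + gOf m - m)
            (fun v hv => by
              have hv' : ¬ ((v : ℕ) + gOf m < m) := (Finset.mem_filter.1 hv).2
              simp only [Finset.coe_range, Set.mem_Iio]
              have := v.2
              omega)
            (fun v hv w hw h => by
              have hv' : ¬ ((v : ℕ) + gOf m < m) := (Finset.mem_filter.1 hv).2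
              have hw' : ¬ ((w : ℕ) + gOf m < m) := (Finset.mem_filter.1 hw).2
              apply Fin.ext
              simp only at h
              omega)
      _ = gOf m := Finset.card_range _
  rw [Fintype.card_of_subtype (freeSet m).powerset fun P => Finset.mem_powerset,
    Finset.card_powerset]
  exact Nat.pow_le_pow_right (by norm_num) hF

/-! ### Size: exact cardinalities of the gate label types -/

set_option synthInstance.maxHeartbeats 400000 in
set_option synthInstance.maxSize 2048 in
/-- The number of tower contexts. -/
theorem card_TCtx (m : ℕ) : Fintype.card (TCtx m) =
    Fintype.card (PSet m) * m * gOf m * 2 ^ (3 * gOf m) +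
      Fintype.card (PSet m) * 2 ^ (3 * gOf m) := by
  rw [← Fintype.card_congr (TCtx.proxyTypeEquiv m)]
  simp only [Fintype.card_sum, Fintype.card_sigma, Finset.sum_const, Finset.card_univ,
    smul_eq_mul, Fintype.card_fin, card_Cd]
  ring

set_option synthInstance.maxHeartbeats 400000 in
set_option synthInstance.maxSize 2048 in
/-- The number of chain contexts. -/
theorem card_ChCtx (m : ℕ) : Fintype.card (ChCtx m) =
    Fintype.card (TCtx m) * Fintype.card (PSet m) * m +
      Fintype.card (PSet m) * 2 ^ (3 * gOf m) * m * (gOf m * gOf m) := by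
  rw [← Fintype.card_congr (ChCtx.proxyTypeEquiv m)]
  simp only [Fintype.card_sum, Fintype.card_sigma, Finset.sum_const, Finset.card_univ,
    smul_eq_mul, Fintype.card_fin, card_Cd]
  ring

set_option synthInstance.maxHeartbeats 400000 in
set_option synthInstance.maxSize 4096 in
/-- The number of block gate kinds. -/
theorem card_BK (m : ℕ) : Fintype.card (BK m) =
    14 * (2 ^ gOf m * 2 ^ gOf m) + 4 * 2 ^ gOf m := by
  rw [← Fintype.card_congr (BK.proxyTypeEquiv m)]
  simp only [Fintype.card_sum, Fintype.card_sigma, Finset.sum_const, Finset.card_univ,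
    smul_eq_mul, Fintype.card_fin, card_K, N]
  ring

set_option synthInstance.maxHeartbeats 400000 in
set_option synthInstance.maxSize 4096 in
/-- The number of F-side gate labels. -/
theorem card_FG (m : ℕ) : Fintype.card (FG m) =
    2 + 2 ^ (3 * gOf m) * 2 ^ gOf m * 2 ^ gOf m +
      Fintype.card (PSet m) * m * gOf m * 2 ^ (3 * gOf m) * 2 ^ gOf m * 2 ^ gOf m +
      Fintype.card (TCtx m) * Fintype.card (PSet m) * 2 ^ gOf m * 2 ^ gOf m +
      Fintype.card (PSet m) * m * gOf m * 2 ^ (3 * gOf m) * m * 2 ^ gOf m * 2 ^ gOf m +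
      Fintype.card (PSet m) * 2 ^ (3 * gOf m) * m * (gOf m * gOf m) * 2 ^ gOf m * 2 ^ gOf m +
      Fintype.card (ChCtx m) * 2 ^ gOf m * Fintype.card (BK m) := by
  rw [← Fintype.card_congr (FG.proxyTypeEquiv m)]
  simp only [Fintype.card_sum, Fintype.card_sigma, Finset.sum_const, Finset.card_univ,
    smul_eq_mul, Fintype.card_fin, Fintype.card_unit, card_K, card_Cd, N]
  ring

/-! ### Size: polynomial bounds -/

/-- At most `2 (m+1)^6` tower contexts. -/
theorem card_TCtx_le (m : ℕ) : Fintype.card (TCtx m) ≤ 2 * (m + 1) ^ 6 := by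
  have hM : 1 ≤ m + 1 := Nat.succ_pos m
  have hm : m ≤ m + 1 := Nat.le_succ m
  have hg : gOf m ≤ m + 1 := (SymA.gOf_le m).trans hm
  have hD := two_pow_three_mul_gOf_le m
  have hP : Fintype.card (PSet m) ≤ m + 1 := (card_PSet_le m).trans (two_pow_gOf_le m)
  rw [card_TCtx]
  calc Fintype.card (PSet m) * m * gOf m * 2 ^ (3 * gOf m) + Fintype.card (PSet m) * 2 ^ (3 * gOf m)
      ≤ (m + 1) * (m + 1) * (m + 1) * (m + 1) ^ 3 + (m + 1) * (m + 1) ^ 3 := by gcongr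
    _ = (m + 1) ^ 6 + (m + 1) ^ 4 := by ring
    _ ≤ (m + 1) ^ 6 + (m + 1) ^ 6 :=
        Nat.add_le_add_left (Nat.pow_le_pow_right hM (by norm_num)) _
    _ = 2 * (m + 1) ^ 6 := by ring

/-- At most `3 (m+1)^8` chain contexts. -/
theorem card_ChCtx_le (m : ℕ) : Fintype.card (ChCtx m) ≤ 3 * (m + 1) ^ 8 := by
  have hM : 1 ≤ m + 1 := Nat.succ_pos m
  have hm : m ≤ m + 1 := Nat.le_succ m
  have hg : gOf m ≤ m + 1 := (SymA.gOf_le m).trans hm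
  have hD := two_pow_three_mul_gOf_le m
  have hP : Fintype.card (PSet m) ≤ m + 1 := (card_PSet_le m).trans (two_pow_gOf_le m)
  have hT := card_TCtx_le m
  rw [card_ChCtx]
  calc Fintype.card (TCtx m) * Fintype.card (PSet m) * m +
        Fintype.card (PSet m) * 2 ^ (3 * gOf m) * m * (gOf m * gOf m)
      ≤ 2 * (m + 1) ^ 6 * (m + 1) * (m + 1) +
        (m + 1) * (m + 1) ^ 3 * (m + 1) * ((m + 1) * (m + 1)) := by gcongr
    _ = 2 * (m + 1) ^ 8 + (m + 1) ^ 7 := by ring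
    _ ≤ 2 * (m + 1) ^ 8 + (m + 1) ^ 8 :=
        Nat.add_le_add_left (Nat.pow_le_pow_right hM (by norm_num)) _
    _ = 3 * (m + 1) ^ 8 := by ring

/-- At most `18 (m+1)^2` block gate kinds. -/
theorem card_BK_le (m : ℕ) : Fintype.card (BK m) ≤ 18 * (m + 1) ^ 2 := by
  have hM : 1 ≤ m + 1 := Nat.succ_pos m
  have h2 := two_pow_gOf_le m
  rw [card_BK]
  calc 14 * (2 ^ gOf m * 2 ^ gOf m) + 4 * 2 ^ gOf m
      ≤ 14 * ((m + 1) * (m + 1)) + 4 * (m + 1) := by gcongr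
    _ = 14 * (m + 1) ^ 2 + 4 * (m + 1) ^ 1 := by ring
    _ ≤ 14 * (m + 1) ^ 2 + 4 * (m + 1) ^ 2 :=
        Nat.add_le_add_left (Nat.mul_le_mul_left 4 (Nat.pow_le_pow_right hM (by norm_num))) _
    _ = 18 * (m + 1) ^ 2 := by ring

/-- At most `62 (m+1)^11` F-side gate labels. -/
theorem card_FG_le (m : ℕ) : Fintype.card (FG m) ≤ 62 * (m + 1) ^ 11 := by
  have hM : 1 ≤ m + 1 := Nat.succ_pos m
  have hm : m ≤ m + 1 := Nat.le_succ m
  have hg : gOf m ≤ m + 1 := (SymA.gOf_le m).trans hm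
  have h2 := two_pow_gOf_le m
  have hD := two_pow_three_mul_gOf_le m
  have hP : Fintype.card (PSet m) ≤ m + 1 := (card_PSet_le m).trans (two_pow_gOf_le m)
  have hT := card_TCtx_le m
  have hC := card_ChCtx_le m
  have hB := card_BK_le m
  have e : ∀ {i : ℕ}, i ≤ 11 → (m + 1) ^ i ≤ (m + 1) ^ 11 :=
    fun hi => Nat.pow_le_pow_right hM hi
  rw [card_FG]
  calc 2 + 2 ^ (3 * gOf m) * 2 ^ gOf m * 2 ^ gOf m +
        Fintype.card (PSet m) * m * gOf m * 2 ^ (3 * gOf m) * 2 ^ gOf m * 2 ^ gOf m +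
        Fintype.card (TCtx m) * Fintype.card (PSet m) * 2 ^ gOf m * 2 ^ gOf m +
        Fintype.card (PSet m) * m * gOf m * 2 ^ (3 * gOf m) * m * 2 ^ gOf m * 2 ^ gOf m +
        Fintype.card (PSet m) * 2 ^ (3 * gOf m) * m * (gOf m * gOf m) * 2 ^ gOf m * 2 ^ gOf m +
        Fintype.card (ChCtx m) * 2 ^ gOf m * Fintype.card (BK m)
      ≤ 2 + (m + 1) ^ 3 * (m + 1) * (m + 1) +
        (m + 1) * (m + 1) * (m + 1) * (m + 1) ^ 3 * (m + 1) * (m + 1) +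
        2 * (m + 1) ^ 6 * (m + 1) * (m + 1) * (m + 1) +
        (m + 1) * (m + 1) * (m + 1) * (m + 1) ^ 3 * (m + 1) * (m + 1) * (m + 1) +
        (m + 1) * (m + 1) ^ 3 * (m + 1) * ((m + 1) * (m + 1)) * (m + 1) * (m + 1) +
        3 * (m + 1) ^ 8 * (m + 1) * (18 * (m + 1) ^ 2) := by gcongr
    _ = 2 * (m + 1) ^ 0 + (m + 1) ^ 5 + (m + 1) ^ 8 + 2 * (m + 1) ^ 9 + (m + 1) ^ 9 +
        (m + 1) ^ 9 + 54 * (m + 1) ^ 11 := by ring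
    _ ≤ 2 * (m + 1) ^ 11 + (m + 1) ^ 11 + (m + 1) ^ 11 + 2 * (m + 1) ^ 11 + (m + 1) ^ 11 +
        (m + 1) ^ 11 + 54 * (m + 1) ^ 11 := by
        gcongr 2 * ?_ + ?_ + ?_ + 2 * ?_ + ?_ + ?_ + _ <;> exact e (by norm_num)
    _ = 62 * (m + 1) ^ 11 := by ring

/-- **Size.** At most `73 (m+1)^11` gate labels in all. -/
theorem card_FΛ_le (m : ℕ) : Fintype.card (FΛ m) ≤ 73 * (m + 1) ^ 11 := by
  have hM : 1 ≤ m + 1 := Nat.succ_pos m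
  rw [Fintype.card_sum]
  calc Fintype.card (SymA.RΛ m) + Fintype.card (FG m)
      ≤ 11 * (m + 1) ^ 3 + 62 * (m + 1) ^ 11 := add_le_add (SymA.card_RΛ_le m) (card_FG_le m)
    _ ≤ 11 * (m + 1) ^ 11 + 62 * (m + 1) ^ 11 :=
        Nat.add_le_add_right (Nat.mul_le_mul_left 11 (Nat.pow_le_pow_right hM (by norm_num))) _
    _ = 73 * (m + 1) ^ 11 := by ring

end FOut

end SymF

/-- **Obligation `stub_symmetricF_out` of the F-side DAG** (size and decoding): the gate type
`SymF.FΛ m` has at most `73 (m + 1)^11` elements, and the F-interface bit `fData m x (e, S, S')` is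
the echelon bit of `Cspan F (dOf e)` at `(S, S')` when `e` is a code word and `false` otherwise. -/
theorem stub_symmetricF_out : SymF.OutProps := by
  refine ⟨⟨Polynomial.C 73 * (Polynomial.X + 1) ^ 11, fun m => ?_⟩,
    fun m x i => @SymF.FOut.fData_eq m x i (_)⟩
  have h : (Polynomial.C 73 * (Polynomial.X + 1) ^ 11 : Polynomial ℕ).eval m =
      73 * (m + 1) ^ 11 := by
    simp
  rw [h]
  exact SymF.FOut.card_FΛ_le m

end Summit.PneNP.PneNP.Theorems.HamCompilesKC
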